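import Mathlib
import HarnessLib

/-!
# Zhang (2022) §8: the arithmetic identity (8.10)

Trunk T-ANT (NumberTheory/LFunctions). Companion of `Section8Defs.lean`, `Section8MainTerms.lean`
(Y. Zhang, *Discrete mean estimates and the Landau–Siegel zero*, arXiv:2211.02515v1 (2022)
[Zhang2022LandauSiegel], §8; **an unrefereed manuscript under adjudication** — this file proves one
elementary identity the manuscript states without proof and asserts nothing about its theorems).

Between Lemma 8.4 and (8.11) [p. 17 of the source] the manuscript substitutes `n = dr` using

* "It can be shown, by verifying the case `n = qᵏ`, that
  `Σ_{n = dr} |μ(r)| r⁻¹ ∏_{(q,r)=1, q ∣ d} (1 − q⁻¹ − χ(q)q⁻¹) = ∏_{q ∣ n} (1 − χ(q)q⁻¹)`"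
  — `sum_squarefree_divisors_local` below (for an arbitrary weight `c q` in place of `χ(q)`; the
  proof is the binomial expansion of `∏_{q ∣ n} (q⁻¹ + (1 − q⁻¹ − c_q q⁻¹))` over the subsets of the
  prime factors of `n`, i.e. over the squarefree divisors `r`, which is the multiplicativity the
  manuscript alludes to);
* "so that `Σ_{n = dr} |μ(r)| φ(r)⁻¹ Π(d,r) = n/φ(n)` (8.10)", where (Lemma 8.3)
  `Π(d,r) = ∏_{q ∣ dr} (1 − χ(q)q⁻¹)⁻¹ ∏_{(q,r)=1, q ∣ d} (1 − q⁻¹ − χ(q)q⁻¹)(1 − q⁻¹)⁻¹`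
  — `PiLocal` and `sum_squarefree_divisors_PiLocal` below, under the only hypothesis the identity
  needs, `c q ≠ q` for the primes `q ∣ n` (automatic for a Dirichlet character: `|χ(q)| ≤ 1 < q`).

Here `|μ(r)|` restricts the sum to squarefree `r ∣ n`, `d = n/r`, and the condition
"`(q, r) = 1, q ∣ d`" on a prime `q` is `q ∣ n, q ∤ r` (`primeFactors_div_filter_coprime`).
-/

noncomputable section

open Finset

namespace Literature.NumberTheory.LFunctions.Zhang2022

/-- For `r ∣ n ≠ 0`, the primes `q` with `q ∣ n/r` and `(q, r) = 1` are exactly the prime factors of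
`n` that do not divide `r` (the index set of the products in Lemma 8.3's `Π(d,r)`, `d = n/r`).
[cite: Zhang2022LandauSiegel, Lemma 8.3] -/
theorem primeFactors_div_filter_coprime {n r : ℕ} (hn : n ≠ 0) (hr : r ∣ n) :
    {q ∈ (n / r).primeFactors | Nat.Coprime q r} = n.primeFactors \ r.primeFactors := by
  have hr0 : r ≠ 0 := by rintro rfl; exact hn (zero_dvd_iff.mp hr)
  have hnr : n / r * r = n := Nat.div_mul_cancel hr
  have hd0 : n / r ≠ 0 := by intro h; rw [h, zero_mul] at hnr; exact hn hnr.symm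
  ext q
  simp only [Finset.mem_filter, Finset.mem_sdiff, Nat.mem_primeFactors]
  constructor
  · rintro ⟨⟨hq, hqd, -⟩, hcop⟩
    refine ⟨⟨hq, hqd.trans ⟨r, hnr.symm⟩, hn⟩, ?_⟩
    rintro ⟨-, hqr, -⟩
    exact (hq.coprime_iff_not_dvd.mp hcop) hqr
  · rintro ⟨⟨hq, hqn, -⟩, hnot⟩
    have hqr : ¬ q ∣ r := fun h => hnot ⟨hq, h, hr0⟩
    refine ⟨⟨hq, ?_, hd0⟩, hq.coprime_iff_not_dvd.mpr hqr⟩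
    rw [← hnr] at hqn
    exact (hq.dvd_mul.mp hqn).resolve_right hqr

/-- The binomial expansion behind the display before (8.10): for any weight `h` on primes and
`n ≠ 0`, `Σ_{r ∣ n squarefree} r⁻¹ ∏_{q ∣ n, q ∤ r} h(q) = ∏_{q ∣ n} (q⁻¹ + h(q))` (subsets of the
prime factors of `n` ↔ squarefree divisors `r`).
[cite: Zhang2022LandauSiegel, §8 (before (8.10))] -/
theorem sum_squarefree_divisors_prod_sdiff (h : ℕ → ℝ) {n : ℕ} (hn : n ≠ 0) :
    ∑ r ∈ n.divisors with Squarefree r,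
        (1 / (r : ℝ)) * ∏ q ∈ n.primeFactors \ r.primeFactors, h q
      = ∏ q ∈ n.primeFactors, (1 / (q : ℝ) + h q) := by
  rw [Finset.prod_add, Nat.sum_divisors_filter_squarefree hn]
  have hPF : (UniqueFactorizationMonoid.normalizedFactors n).toFinset = n.primeFactors := by
    rw [Nat.factors_eq]; rfl
  rw [hPF]
  refine Finset.sum_congr rfl (fun t ht => ?_)
  rw [Finset.mem_powerset] at ht
  have hprime : ∀ q ∈ t, q.Prime := fun q hq => Nat.prime_of_mem_primeFactors (ht hq)
  have hval : t.val.prod = ∏ q ∈ t, q := by rw [Finset.prod_val]; rfl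
  rw [hval, Nat.primeFactors_prod hprime, Nat.cast_prod, one_div, ← Finset.prod_inv_distrib]
  simp only [one_div]

/-- The display before (8.10) [p. 17]: for `n ≠ 0` and any weight `c` (the manuscript's `χ(q)`),
`Σ_{n = dr} |μ(r)| r⁻¹ ∏_{(q,r)=1, q ∣ d} (1 − q⁻¹ − c(q)q⁻¹) = ∏_{q ∣ n} (1 − c(q)q⁻¹)`
("It can be shown, by verifying the case `n = qᵏ`").
[cite: Zhang2022LandauSiegel, §8 (before (8.10))] -/
theorem sum_squarefree_divisors_local (c : ℕ → ℝ) {n : ℕ} (hn : n ≠ 0) :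
    ∑ r ∈ n.divisors with Squarefree r,
        (1 / (r : ℝ)) * ∏ q ∈ (n / r).primeFactors with Nat.Coprime q r, (1 - 1 / (q : ℝ) - c q / q)
      = ∏ q ∈ n.primeFactors, (1 - c q / q) := by
  have step : ∀ r ∈ n.divisors.filter Squarefree,
      (1 / (r : ℝ)) * ∏ q ∈ (n / r).primeFactors with Nat.Coprime q r, (1 - 1 / (q : ℝ) - c q / q)
        = (1 / (r : ℝ)) * ∏ q ∈ n.primeFactors \ r.primeFactors, (1 - 1 / (q : ℝ) - c q / q) := by
    intro r hr
    rw [Finset.mem_filter, Nat.mem_divisors] at hr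
    rw [primeFactors_div_filter_coprime hn hr.1.1]
  rw [Finset.sum_congr rfl step, sum_squarefree_divisors_prod_sdiff _ hn]
  exact Finset.prod_congr rfl (fun q _ => by ring)

/-- Lemma 8.3's local factor with a weight `c` in place of `χ`:
`Π(d,r) = ∏_{q ∣ dr} (1 − c(q)q⁻¹)⁻¹ · ∏_{(q,r)=1, q ∣ d} (1 − q⁻¹ − c(q)q⁻¹)(1 − q⁻¹)⁻¹`.
[cite: Zhang2022LandauSiegel, Lemma 8.3] -/
def PiLocal (c : ℕ → ℝ) (d r : ℕ) : ℝ :=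
  (∏ q ∈ (d * r).primeFactors, (1 - c q / q)⁻¹) *
    ∏ q ∈ d.primeFactors with Nat.Coprime q r, (1 - 1 / (q : ℝ) - c q / q) / (1 - 1 / q)

/-- Euler's product for `φ` over `ℝ`: `φ(n) = n ∏_{q ∣ n} (1 − q⁻¹)`. [folklore] -/
theorem totient_eq_mul_prod_real (n : ℕ) :
    (Nat.totient n : ℝ) = n * ∏ q ∈ n.primeFactors, (1 - 1 / (q : ℝ)) := by
  have h := Nat.totient_eq_mul_prod_factors n
  have h' : ((Nat.totient n : ℚ) : ℝ) = ((n * ∏ p ∈ n.primeFactors, (1 - (p : ℚ)⁻¹) : ℚ) : ℝ) := by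
    rw [h]
  push_cast at h'
  simpa only [one_div] using h'

/-- **(8.10)** [p. 17]: for `n ≠ 0` and any weight `c` with `c(q) ≠ q` for the primes `q ∣ n`
(so that `1 − c(q)q⁻¹ ≠ 0`; automatic for a Dirichlet character),
`Σ_{n = dr} |μ(r)| φ(r)⁻¹ Π(d,r) = n/φ(n)`. Proof: `φ(r)⁻¹ = r⁻¹ ∏_{q ∣ r}(1 − q⁻¹)⁻¹`,
`∏_{q ∣ r} (1 − q⁻¹) ∏_{q ∣ n, q ∤ r} (1 − q⁻¹) = ∏_{q ∣ n} (1 − q⁻¹) = φ(n)/n`, and the previous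
display. [cite: Zhang2022LandauSiegel, (8.10)] -/
theorem sum_squarefree_divisors_PiLocal (c : ℕ → ℝ) {n : ℕ} (hn : n ≠ 0)
    (hc : ∀ q ∈ n.primeFactors, c q ≠ q) :
    ∑ r ∈ n.divisors with Squarefree r, (1 / (Nat.totient r : ℝ)) * PiLocal c (n / r) r
      = n / Nat.totient n := by
  set F : ℝ := ∏ q ∈ n.primeFactors, (1 - c q / q)⁻¹ with hF
  set G : ℝ := ∏ q ∈ n.primeFactors, (1 - 1 / (q : ℝ)) with hG
  set hh : ℕ → ℝ := fun q => 1 - 1 / (q : ℝ) - c q / q with hh_def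
  have hGne : G ≠ 0 := by
    refine Finset.prod_ne_zero_iff.mpr (fun q hq => ?_)
    have hq2 : (2 : ℝ) ≤ q := by exact_mod_cast (Nat.prime_of_mem_primeFactors hq).two_le
    have : (0 : ℝ) < 1 - 1 / q := by
      rw [sub_pos, div_lt_one (by linarith)]; linarith
    exact this.ne'
  -- each term, rewritten
  have step : ∀ r ∈ n.divisors.filter Squarefree,
      (1 / (Nat.totient r : ℝ)) * PiLocal c (n / r) r
        = F * G⁻¹ * ((1 / (r : ℝ)) * ∏ q ∈ n.primeFactors \ r.primeFactors, hh q) := by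
    intro r hr
    rw [Finset.mem_filter, Nat.mem_divisors] at hr
    have hrn : r ∣ n := hr.1.1
    have hr0 : r ≠ 0 := by rintro rfl; exact hn (zero_dvd_iff.mp hrn)
    have hsub : r.primeFactors ⊆ n.primeFactors := Nat.primeFactors_mono hrn hn
    have hGr : ∏ q ∈ r.primeFactors, (1 - 1 / (q : ℝ)) ≠ 0 := by
      refine Finset.prod_ne_zero_iff.mpr (fun q hq => ?_)
      have hq2 : (2 : ℝ) ≤ q := by exact_mod_cast (Nat.prime_of_mem_primeFactors hq).two_le
      have : (0 : ℝ) < 1 - 1 / q := by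
        rw [sub_pos, div_lt_one (by linarith)]; linarith
      exact this.ne'
    have hGs : ∏ q ∈ n.primeFactors \ r.primeFactors, (1 - 1 / (q : ℝ)) ≠ 0 := by
      refine Finset.prod_ne_zero_iff.mpr (fun q hq => ?_)
      have hq2 : (2 : ℝ) ≤ q := by
        exact_mod_cast (Nat.prime_of_mem_primeFactors (Finset.mem_sdiff.mp hq).1).two_le
      have : (0 : ℝ) < 1 - 1 / q := by
        rw [sub_pos, div_lt_one (by linarith)]; linarith
      exact this.ne'
    have hsplit : (∏ q ∈ n.primeFactors \ r.primeFactors, (1 - 1 / (q : ℝ)))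
        * ∏ q ∈ r.primeFactors, (1 - 1 / (q : ℝ)) = G := Finset.prod_sdiff hsub
    have hr0' : (r : ℝ) ≠ 0 := by exact_mod_cast hr0
    unfold PiLocal
    rw [Nat.div_mul_cancel hrn, primeFactors_div_filter_coprime hn hrn, Finset.prod_div_distrib,
      totient_eq_mul_prod_real r, ← hF]
    simp only [hh_def]
    rw [← hsplit]
    field_simp
  rw [Finset.sum_congr rfl step, ← Finset.mul_sum, sum_squarefree_divisors_prod_sdiff hh hn]
  have hprod : F * ∏ q ∈ n.primeFactors, (1 / (q : ℝ) + hh q) = 1 := by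
    rw [hF, ← Finset.prod_mul_distrib]
    refine Finset.prod_eq_one (fun q hq => ?_)
    have hq0 : (q : ℝ) ≠ 0 := by exact_mod_cast (Nat.prime_of_mem_primeFactors hq).ne_zero
    have hcq : (1 : ℝ) - c q / q ≠ 0 := by
      intro h0
      apply hc q hq
      field_simp at h0
      linarith
    simp only [hh_def]
    rw [show 1 / (q : ℝ) + (1 - 1 / q - c q / q) = 1 - c q / q by ring]
    exact inv_mul_cancel₀ hcq
  rw [totient_eq_mul_prod_real n, ← hG]
  have hn' : (n : ℝ) ≠ 0 := by exact_mod_cast hn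
  calc F * G⁻¹ * ∏ q ∈ n.primeFactors, (1 / (q : ℝ) + hh q)
      = G⁻¹ * (F * ∏ q ∈ n.primeFactors, (1 / (q : ℝ) + hh q)) := by ring
    _ = (n : ℝ) / (n * G) := by rw [hprod]; field_simp

end Literature.NumberTheory.LFunctions.Zhang2022
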